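import Summits.CriticalPhenomena.PercolationContinuityZ3.Theorems.PercNearOneGluingNoHeavyLowerTailKnQuestion8CoefficientwiseCoreClassKernelMixHubBundleJoin
import Summits.CriticalPhenomena.PercolationContinuityZ3.Theorems.PercNearOneGluingNoHeavyLowerTailKnQuestion8CoefficientwiseCoreClassKernelMixHubWalls
import HarnessLib

/-!
# Bundle words: the hub traces under the split of the last thread (glue for H≼_J on all bundles, layer 2 = the CLOSURE LEMMA)

Support file (`--supports stmt-CriticalPhenomena-4575`, closed), prover `prim-cplus-coupling` (gen 52).  No definitions, no notations,
no named facts, no sorries; standard axioms.  Memo `prim-cplus-coupling/A5-COUPLING-gen50.md` §2.6 (CLOSURE LEMMA), `A5-COUPLING-gen51.md` §7(2).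

Setting of `…KernelMixHubBundleJoin` (`hE`, `hθ`).  Per thread `t` the word `η = θ t ω ⊆ [1, ℓ t]` has wall set `D t η` and hub runs
`ri, ra, rj, rb` (leading red / blue, trailing red / blue) given by the wall formulas of `…KernelMixHubWalls` with `ℓ := ℓ t`.
The HUB TRACES of a word of `Θ_n` are index sets `⊆ {(t, k) : t < n, 0 ≤ k ≤ ℓ t}` (`(t,0) ↦ u`, `(t, ℓ t) ↦ b`):
generic shape (hypothesis `hT`)
  `T g n ω = ⋃_{t<n} {t} × ([0, f t η_t] ∪ (if g ∨ (∃ s<n, f s η_s = ℓ s) then [ℓ t − h t η_t, ℓ t] else ∅))`,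
with `(f, h) = (ri, rj)` the RED traces (`g = false`: `C_u(ω)`, a thread being fully red iff `ri = ℓ`; `g = true`: `C_u ∪ C_b`) and with
`(f, h) = (ra, rb)` the BLUE traces (the red traces of the complement: `hubB_trace_compl`).  The file proves the CLOSURE LEMMA in
word form: the traces of a join `ω' ∪ ζ.image (Prod.mk r)` in terms of the traces of `ω'` in `Θ_r` and of the path word `ζ`
(`hubB_trace_join`, `hubB_trace_join_pathForm`, `hubB_trace_join_sliceForm`) — each a monotone substitution into a trace of
one factor, with the gate of that factor switched to `j` exactly when the other factor contains the hub `b`.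
[cite: KozmaNitzan2024, Questions 8–9 (§5.5 p. 36) (context)]
-/

namespace Summit.CriticalPhenomena.PercolationContinuityZ3.Theorems

open Finset
open scoped symmDiff

namespace Coefficientwise

/-- Membership in a guarded interval. [folklore] -/
theorem hubB_mem_ite_empty {γ : Type*} (c : Prop) [Decidable c] (s : Finset γ) (k : γ) :
    k ∈ (if c then s else ∅) ↔ c ∧ k ∈ s := by
  split_ifs with hc
  · simp [hc]
  · simp [hc]

/-- The wall-formula runs are at most `ℓ`. [folklore] -/
theorem hubB_runs_le (L : ℕ) (D : Finset ℕ → Finset ℕ)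
    (hD : ∀ ω, D ω = (Icc 1 (L - 1)).filter (fun k => ¬ (k ∈ ω ↔ k + 1 ∈ ω)))
    (ri ra rj rb : Finset ℕ → ℕ)
    (hri : ∀ ω, ri ω = if 1 ∈ ω then (if h : (D ω).Nonempty then (D ω).min' h else L) else 0)
    (hra : ∀ ω, ra ω = if 1 ∈ ω then 0 else (if h : (D ω).Nonempty then (D ω).min' h else L))
    (hrj : ∀ ω, rj ω = if L ∈ ω then (if h : (D ω).Nonempty then L - (D ω).max' h else L) else 0)
    (hrb : ∀ ω, rb ω = if L ∈ ω then 0 else (if h : (D ω).Nonempty then L - (D ω).max' h else L))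
    (ω : Finset ℕ) : ri ω ≤ L ∧ ra ω ≤ L ∧ rj ω ≤ L ∧ rb ω ≤ L := by
  have hb := fun k hk => walls_bounds L D hD ω k hk
  refine ⟨?_, ?_, ?_, ?_⟩
  · rw [hri]; split_ifs with h1 h
    · have := hb _ ((D ω).min'_mem h); omega
    · exact le_refl _
    · exact Nat.zero_le _
  · rw [hra]; split_ifs with h1 h
    · exact Nat.zero_le _
    · have := hb _ ((D ω).min'_mem h); omega
    · exact le_refl _
  · rw [hrj]; split_ifs with h1 h
    · omega
    · exact le_refl _
    · exact Nat.zero_le _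
  · rw [hrb]; split_ifs with h1 h
    · exact Nat.zero_le _
    · omega
    · exact le_refl _

/-- **Runs of the complement**: complementing a path word swaps `ri ↔ ra` and `rj ↔ rb`. [folklore] -/
theorem hubB_runs_compl (L : ℕ) (hL : 1 ≤ L) (D : Finset ℕ → Finset ℕ)
    (hD : ∀ ω, D ω = (Icc 1 (L - 1)).filter (fun k => ¬ (k ∈ ω ↔ k + 1 ∈ ω)))
    (ri ra rj rb : Finset ℕ → ℕ)
    (hri : ∀ ω, ri ω = if 1 ∈ ω then (if h : (D ω).Nonempty then (D ω).min' h else L) else 0)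
    (hra : ∀ ω, ra ω = if 1 ∈ ω then 0 else (if h : (D ω).Nonempty then (D ω).min' h else L))
    (hrj : ∀ ω, rj ω = if L ∈ ω then (if h : (D ω).Nonempty then L - (D ω).max' h else L) else 0)
    (hrb : ∀ ω, rb ω = if L ∈ ω then 0 else (if h : (D ω).Nonempty then L - (D ω).max' h else L))
    (ω : Finset ℕ) :
    ri (Icc 1 L \ ω) = ra ω ∧ ra (Icc 1 L \ ω) = ri ω ∧ rj (Icc 1 L \ ω) = rb ω ∧ rb (Icc 1 L \ ω) = rj ω := by
  have hc := walls_compl L hL D hD ω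
  have h1 : (1 ∈ Icc 1 L \ ω) ↔ 1 ∉ ω := by
    rw [Finset.mem_sdiff, Finset.mem_Icc]; constructor
    · exact fun h => h.2
    · exact fun h => ⟨⟨le_refl _, hL⟩, h⟩
  have hL' : (L ∈ Icc 1 L \ ω) ↔ L ∉ ω := by
    rw [Finset.mem_sdiff, Finset.mem_Icc]; constructor
    · exact fun h => h.2
    · exact fun h => ⟨⟨hL, le_refl _⟩, h⟩
  refine ⟨?_, ?_, ?_, ?_⟩
  · rw [hri, hra, hc]
    by_cases h : 1 ∈ ω
    · rw [if_neg (fun h' => (h1.mp h') h), if_pos h]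
    · rw [if_pos (h1.mpr h), if_neg h]
  · rw [hra, hri, hc]
    by_cases h : 1 ∈ ω
    · rw [if_neg (fun h' => (h1.mp h') h), if_pos h]
    · rw [if_pos (h1.mpr h), if_neg h]
  · rw [hrj, hrb, hc]
    by_cases h : L ∈ ω
    · rw [if_neg (fun h' => (hL'.mp h') h), if_pos h]
    · rw [if_pos (hL'.mpr h), if_neg h]
  · rw [hrb, hrj, hc]
    by_cases h : L ∈ ω
    · rw [if_neg (fun h' => (hL'.mp h') h), if_pos h]
    · rw [if_pos (hL'.mpr h), if_neg h]

open Classical in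
/-- **Membership in a hub trace** (generic shape `(f, h)`). [folklore] -/
theorem hubB_mem_trace (ℓ : ℕ → ℕ) (θ : ℕ → Finset (ℕ × ℕ) → Finset ℕ) (f h : ℕ → Finset ℕ → ℕ)
    (T : Bool → ℕ → Finset (ℕ × ℕ) → Finset (ℕ × ℕ))
    (hT : ∀ g n ω, T g n ω = (range n).biUnion (fun t => (Icc 0 (f t (θ t ω)) ∪
      (if (g = true ∨ ∃ s, s < n ∧ f s (θ s ω) = ℓ s) then Icc (ℓ t - h t (θ t ω)) (ℓ t) else ∅)).image (Prod.mk t)))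
    (g : Bool) (n : ℕ) (ω : Finset (ℕ × ℕ)) (p : ℕ × ℕ) :
    p ∈ T g n ω ↔ p.1 < n ∧ (p.2 ≤ f p.1 (θ p.1 ω) ∨
      ((g = true ∨ ∃ s, s < n ∧ f s (θ s ω) = ℓ s) ∧ ℓ p.1 - h p.1 (θ p.1 ω) ≤ p.2 ∧ p.2 ≤ ℓ p.1)) := by
  rw [hT, Finset.mem_biUnion]
  constructor
  · rintro ⟨t, ht, hp⟩
    rw [hubB_mem_image_mk] at hp
    obtain ⟨rfl, hp2⟩ := hp
    refine ⟨Finset.mem_range.mp ht, ?_⟩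
    rw [Finset.mem_union, Finset.mem_Icc, hubB_mem_ite_empty, Finset.mem_Icc] at hp2
    rcases hp2 with ⟨_, h2⟩ | ⟨hc, h2, h3⟩
    · exact Or.inl h2
    · exact Or.inr ⟨hc, h2, h3⟩
  · rintro ⟨hn, hp⟩
    refine ⟨p.1, Finset.mem_range.mpr hn, ?_⟩
    rw [hubB_mem_image_mk]
    refine ⟨rfl, ?_⟩
    rw [Finset.mem_union, Finset.mem_Icc, hubB_mem_ite_empty, Finset.mem_Icc]
    rcases hp with h2 | ⟨hc, h2, h3⟩
    · exact Or.inl ⟨Nat.zero_le _, h2⟩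
    · exact Or.inr ⟨hc, h2, h3⟩

open Classical in
/-- The `u`-gate trace is contained in the `j`-gate trace. [folklore] -/
theorem hubB_trace_mono_gate (ℓ : ℕ → ℕ) (θ : ℕ → Finset (ℕ × ℕ) → Finset ℕ) (f h : ℕ → Finset ℕ → ℕ)
    (T : Bool → ℕ → Finset (ℕ × ℕ) → Finset (ℕ × ℕ))
    (hT : ∀ g n ω, T g n ω = (range n).biUnion (fun t => (Icc 0 (f t (θ t ω)) ∪
      (if (g = true ∨ ∃ s, s < n ∧ f s (θ s ω) = ℓ s) then Icc (ℓ t - h t (θ t ω)) (ℓ t) else ∅)).image (Prod.mk t)))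
    (g : Bool) (n : ℕ) (ω : Finset (ℕ × ℕ)) : T g n ω ⊆ T true n ω := by
  intro p hp
  rw [hubB_mem_trace ℓ θ f h T hT] at hp ⊢
  rcases hp with ⟨hn, h2 | ⟨_, h2, h3⟩⟩
  · exact ⟨hn, Or.inl h2⟩
  · exact ⟨hn, Or.inr ⟨Or.inl rfl, h2, h3⟩⟩

open Classical in
/-- When some thread is saturated (`f s = ℓ s`, i.e. the hub `b` lies in the trace) the two gates agree. [folklore] -/
theorem hubB_trace_gate_of_sat (ℓ : ℕ → ℕ) (θ : ℕ → Finset (ℕ × ℕ) → Finset ℕ) (f h : ℕ → Finset ℕ → ℕ)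
    (T : Bool → ℕ → Finset (ℕ × ℕ) → Finset (ℕ × ℕ))
    (hT : ∀ g n ω, T g n ω = (range n).biUnion (fun t => (Icc 0 (f t (θ t ω)) ∪
      (if (g = true ∨ ∃ s, s < n ∧ f s (θ s ω) = ℓ s) then Icc (ℓ t - h t (θ t ω)) (ℓ t) else ∅)).image (Prod.mk t)))
    (g : Bool) (n : ℕ) (ω : Finset (ℕ × ℕ)) (hsat : ∃ s, s < n ∧ f s (θ s ω) = ℓ s) : T g n ω = T true n ω := by
  refine Finset.Subset.antisymm (hubB_trace_mono_gate ℓ θ f h T hT g n ω) fun p hp => ?_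
  rw [hubB_mem_trace ℓ θ f h T hT] at hp ⊢
  rcases hp with ⟨hn, h2 | ⟨_, h2, h3⟩⟩
  · exact ⟨hn, Or.inl h2⟩
  · exact ⟨hn, Or.inr ⟨Or.inr hsat, h2, h3⟩⟩

open Classical in
/-- **The hub `b` in a trace**: some `(t, ℓ t)` (`t < n`) lies in `T g n ω` iff the gate is `j` (and `n ≥ 1`) or some thread is
saturated. [folklore] -/
theorem hubB_trace_hasB (ℓ : ℕ → ℕ) (θ : ℕ → Finset (ℕ × ℕ) → Finset ℕ) (f h : ℕ → Finset ℕ → ℕ)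
    (hf : ∀ t η, f t η ≤ ℓ t)
    (T : Bool → ℕ → Finset (ℕ × ℕ) → Finset (ℕ × ℕ))
    (hT : ∀ g n ω, T g n ω = (range n).biUnion (fun t => (Icc 0 (f t (θ t ω)) ∪
      (if (g = true ∨ ∃ s, s < n ∧ f s (θ s ω) = ℓ s) then Icc (ℓ t - h t (θ t ω)) (ℓ t) else ∅)).image (Prod.mk t)))
    (g : Bool) (n : ℕ) (ω : Finset (ℕ × ℕ)) :
    (∃ t, t < n ∧ (t, ℓ t) ∈ T g n ω) ↔ (g = true ∧ 0 < n) ∨ ∃ s, s < n ∧ f s (θ s ω) = ℓ s := by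
  constructor
  · rintro ⟨t, ht, hmem⟩
    rw [hubB_mem_trace ℓ θ f h T hT] at hmem
    rcases hmem with ⟨_, h2 | ⟨hc, _, _⟩⟩
    · right; exact ⟨t, ht, le_antisymm (hf t _) h2⟩
    · rcases hc with hg | hs
      · exact Or.inl ⟨hg, by omega⟩
      · exact Or.inr hs
  · rintro (⟨hg, hn⟩ | ⟨s, hs, hfs⟩)
    · refine ⟨0, hn, ?_⟩
      rw [hubB_mem_trace ℓ θ f h T hT]
      exact ⟨hn, Or.inr ⟨Or.inl hg, Nat.sub_le _ _, le_refl _⟩⟩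
    · refine ⟨s, hs, ?_⟩
      rw [hubB_mem_trace ℓ θ f h T hT]
      exact ⟨hs, Or.inl (by rw [hfs])⟩

open Classical in
/-- **CLOSURE LEMMA (word form): the trace of a join.**  For `ω' ⊆ E r` and a path word `ζ`,
`T g (r+1) (ω' ∪ ζ̃) = T (g ∨ [ζ saturated]) r ω' ∪ {r} × ([0, f r ζ] ∪ (if g ∨ [ω' saturated] ∨ [ζ saturated] then [ℓ r − h r ζ, ℓ r] else ∅))`.
[folklore] -/
theorem hubB_trace_join (ℓ : ℕ → ℕ) (E : ℕ → Finset (ℕ × ℕ)) (hE : ∀ n p, p ∈ E n ↔ p.1 < n ∧ 1 ≤ p.2 ∧ p.2 ≤ ℓ p.1)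
    (θ : ℕ → Finset (ℕ × ℕ) → Finset ℕ) (hθ : ∀ t ω k, k ∈ θ t ω ↔ (t, k) ∈ ω) (f h : ℕ → Finset ℕ → ℕ)
    (T : Bool → ℕ → Finset (ℕ × ℕ) → Finset (ℕ × ℕ))
    (hT : ∀ g n ω, T g n ω = (range n).biUnion (fun t => (Icc 0 (f t (θ t ω)) ∪
      (if (g = true ∨ ∃ s, s < n ∧ f s (θ s ω) = ℓ s) then Icc (ℓ t - h t (θ t ω)) (ℓ t) else ∅)).image (Prod.mk t)))
    (g : Bool) (r : ℕ) (ω' : Finset (ℕ × ℕ)) (hω' : ω' ⊆ E r) (ζ : Finset ℕ) :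
    T g (r + 1) (ω' ∪ ζ.image (Prod.mk r)) =
      T (g || decide (f r ζ = ℓ r)) r ω' ∪ (Icc 0 (f r ζ) ∪
        (if (g = true ∨ (∃ s, s < r ∧ f s (θ s ω') = ℓ s) ∨ f r ζ = ℓ r) then Icc (ℓ r - h r ζ) (ℓ r) else ∅)).image (Prod.mk r) := by
  have hθt : ∀ t, t < r → θ t (ω' ∪ ζ.image (Prod.mk r)) = θ t ω' :=
    fun t ht => hubB_theta_join_ne θ hθ r ω' ζ t (by omega)
  have hθr : θ r (ω' ∪ ζ.image (Prod.mk r)) = ζ := hubB_theta_join_self ℓ E hE θ hθ r ω' hω' ζ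
  -- the saturation flag at level r+1
  have hflag : (∃ s, s < r + 1 ∧ f s (θ s (ω' ∪ ζ.image (Prod.mk r))) = ℓ s) ↔
      ((∃ s, s < r ∧ f s (θ s ω') = ℓ s) ∨ f r ζ = ℓ r) := by
    constructor
    · rintro ⟨s, hs, hfs⟩
      by_cases hsr : s < r
      · left; exact ⟨s, hsr, by rw [← hθt s hsr]; exact hfs⟩
      · have : s = r := by omega
        subst this
        right; rw [← hθr]; exact hfs
    · rintro (⟨s, hs, hfs⟩ | hfr)
      · exact ⟨s, by omega, by rw [hθt s hs]; exact hfs⟩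
      · exact ⟨r, Nat.lt_succ_self r, by rw [hθr]; exact hfr⟩
  have hflag' : ((g || decide (f r ζ = ℓ r)) = true ∨ ∃ s, s < r ∧ f s (θ s ω') = ℓ s) ↔
      (g = true ∨ (∃ s, s < r ∧ f s (θ s ω') = ℓ s) ∨ f r ζ = ℓ r) := by
    rw [Bool.or_eq_true, decide_eq_true_eq]
    constructor
    · rintro ((h1 | h1) | h1)
      · exact Or.inl h1
      · exact Or.inr (Or.inr h1)
      · exact Or.inr (Or.inl h1)
    · rintro (h1 | h1 | h1)
      · exact Or.inl (Or.inl h1)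
      · exact Or.inr h1
      · exact Or.inl (Or.inr h1)
  ext p
  rw [hubB_mem_trace ℓ θ f h T hT, Finset.mem_union, hubB_mem_trace ℓ θ f h T hT, hubB_mem_image_mk, hflag, hflag',
    Finset.mem_union, Finset.mem_Icc, hubB_mem_ite_empty, Finset.mem_Icc]
  constructor
  · rintro ⟨hp1, hp⟩
    by_cases hlt : p.1 < r
    · left
      refine ⟨hlt, ?_⟩
      rw [hθt p.1 hlt] at hp
      rcases hp with h2 | ⟨hc, h2, h3⟩
      · exact Or.inl h2
      · exact Or.inr ⟨by tauto, h2, h3⟩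
    · right
      have hpr : p.1 = r := by omega
      refine ⟨hpr, ?_⟩
      rw [hpr, hθr] at hp
      rcases hp with h2 | ⟨hc, h2, h3⟩
      · exact Or.inl ⟨Nat.zero_le _, h2⟩
      · exact Or.inr ⟨by tauto, h2, h3⟩
  · rintro (⟨hlt, hp⟩ | ⟨hpr, hp⟩)
    · refine ⟨by omega, ?_⟩
      rw [hθt p.1 hlt]
      rcases hp with h2 | ⟨hc, h2, h3⟩
      · exact Or.inl h2
      · exact Or.inr ⟨by tauto, h2, h3⟩
    · refine ⟨by omega, ?_⟩
      rw [hpr, hθr]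
      rcases hp with ⟨_, h2⟩ | ⟨hc, h2, h3⟩
      · exact Or.inl h2
      · exact Or.inr ⟨by tauto, h2, h3⟩

open Classical in
/-- **Trace of a join, read from the path** (the slice at fixed `ω'`): with `P = [0, f r ζ] ∪ (if g ∨ [ω' saturated] then
[ℓ r − h r ζ, ℓ r] else ∅)` (the path's own trace with gate `g ∨ [ω' saturated]`),
`T g (r+1) (ω' ∪ ζ̃) = (if ℓ r ∈ P then T true r ω' else T false r ω') ∪ {r} × P` — a monotone substitution in `P`. [folklore] -/
theorem hubB_trace_join_pathForm (ℓ : ℕ → ℕ) (E : ℕ → Finset (ℕ × ℕ)) (hE : ∀ n p, p ∈ E n ↔ p.1 < n ∧ 1 ≤ p.2 ∧ p.2 ≤ ℓ p.1)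
    (θ : ℕ → Finset (ℕ × ℕ) → Finset ℕ) (hθ : ∀ t ω k, k ∈ θ t ω ↔ (t, k) ∈ ω) (f h : ℕ → Finset ℕ → ℕ)
    (hf : ∀ t η, f t η ≤ ℓ t)
    (T : Bool → ℕ → Finset (ℕ × ℕ) → Finset (ℕ × ℕ))
    (hT : ∀ g n ω, T g n ω = (range n).biUnion (fun t => (Icc 0 (f t (θ t ω)) ∪
      (if (g = true ∨ ∃ s, s < n ∧ f s (θ s ω) = ℓ s) then Icc (ℓ t - h t (θ t ω)) (ℓ t) else ∅)).image (Prod.mk t)))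
    (g : Bool) (r : ℕ) (ω' : Finset (ℕ × ℕ)) (hω' : ω' ⊆ E r) (ζ : Finset ℕ) (P : Finset ℕ)
    (hP : P = Icc 0 (f r ζ) ∪ (if (g = true ∨ ∃ s, s < r ∧ f s (θ s ω') = ℓ s) then Icc (ℓ r - h r ζ) (ℓ r) else ∅)) :
    T g (r + 1) (ω' ∪ ζ.image (Prod.mk r)) = (if ℓ r ∈ P then T true r ω' else T false r ω') ∪ P.image (Prod.mk r) := by
  rw [hubB_trace_join ℓ E hE θ hθ f h T hT g r ω' hω' ζ]
  have hmemP : ℓ r ∈ P ↔ (f r ζ = ℓ r ∨ g = true ∨ ∃ s, s < r ∧ f s (θ s ω') = ℓ s) := by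
    rw [hP, Finset.mem_union, Finset.mem_Icc, hubB_mem_ite_empty, Finset.mem_Icc]
    constructor
    · rintro (⟨_, h2⟩ | ⟨hc, _, _⟩)
      · exact Or.inl (le_antisymm (hf r ζ) h2)
      · exact Or.inr hc
    · rintro (h1 | hc)
      · exact Or.inl ⟨Nat.zero_le _, by rw [h1]⟩
      · exact Or.inr ⟨hc, Nat.sub_le _ _, le_refl _⟩
  -- the Θ_r part
  have hpart1 : T (g || decide (f r ζ = ℓ r)) r ω' = (if ℓ r ∈ P then T true r ω' else T false r ω') := by
    by_cases hsat : ∃ s, s < r ∧ f s (θ s ω') = ℓ s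
    · rw [hubB_trace_gate_of_sat ℓ θ f h T hT _ r ω' hsat]
      split_ifs
      · rfl
      · exact (hubB_trace_gate_of_sat ℓ θ f h T hT false r ω' hsat).symm
    · by_cases hm : ℓ r ∈ P
      · rw [if_pos hm]
        have : (g || decide (f r ζ = ℓ r)) = true := by
          rw [Bool.or_eq_true, decide_eq_true_eq]
          rcases hmemP.mp hm with h1 | h1 | h1
          · exact Or.inr h1
          · exact Or.inl h1
          · exact absurd h1 hsat
        rw [this]
      · rw [if_neg hm]
        have : (g || decide (f r ζ = ℓ r)) = false := by
          rw [Bool.or_eq_false_iff, decide_eq_false_iff_not]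
          constructor
          · cases g
            · rfl
            · exact absurd (hmemP.mpr (Or.inr (Or.inl rfl))) hm
          · exact fun h1 => hm (hmemP.mpr (Or.inl h1))
        rw [this]
  -- the path part
  have hpart2 : Icc 0 (f r ζ) ∪ (if (g = true ∨ (∃ s, s < r ∧ f s (θ s ω') = ℓ s) ∨ f r ζ = ℓ r)
      then Icc (ℓ r - h r ζ) (ℓ r) else ∅) = P := by
    rw [hP]
    ext k
    rw [Finset.mem_union, Finset.mem_union, hubB_mem_ite_empty, hubB_mem_ite_empty, Finset.mem_Icc, Finset.mem_Icc]
    constructor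
    · rintro (h1 | ⟨hc, h2, h3⟩)
      · exact Or.inl h1
      · rcases hc with hc | hc | hc
        · exact Or.inr ⟨Or.inl hc, h2, h3⟩
        · exact Or.inr ⟨Or.inr hc, h2, h3⟩
        · exact Or.inl ⟨Nat.zero_le _, by rw [hc]; exact h3⟩
    · rintro (h1 | ⟨hc, h2, h3⟩)
      · exact Or.inl h1
      · exact Or.inr ⟨hc.elim Or.inl (fun h1 => Or.inr (Or.inl h1)), h2, h3⟩
  rw [hpart1, hpart2]

open Classical in
/-- **Trace of a join, read from `Θ_r`** (the slice at fixed `ζ`): with `S = T (g ∨ [ζ saturated]) r ω'`,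
`T g (r+1) (ω' ∪ ζ̃) = S ∪ {r} × ([0, f r ζ] ∪ (if g ∨ [ζ saturated] ∨ [some (t, ℓ t) ∈ S, t < r] then [ℓ r − h r ζ, ℓ r] else ∅))`
— a monotone substitution in `S`. [folklore] -/
theorem hubB_trace_join_sliceForm (ℓ : ℕ → ℕ) (E : ℕ → Finset (ℕ × ℕ)) (hE : ∀ n p, p ∈ E n ↔ p.1 < n ∧ 1 ≤ p.2 ∧ p.2 ≤ ℓ p.1)
    (θ : ℕ → Finset (ℕ × ℕ) → Finset ℕ) (hθ : ∀ t ω k, k ∈ θ t ω ↔ (t, k) ∈ ω) (f h : ℕ → Finset ℕ → ℕ)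
    (hf : ∀ t η, f t η ≤ ℓ t)
    (T : Bool → ℕ → Finset (ℕ × ℕ) → Finset (ℕ × ℕ))
    (hT : ∀ g n ω, T g n ω = (range n).biUnion (fun t => (Icc 0 (f t (θ t ω)) ∪
      (if (g = true ∨ ∃ s, s < n ∧ f s (θ s ω) = ℓ s) then Icc (ℓ t - h t (θ t ω)) (ℓ t) else ∅)).image (Prod.mk t)))
    (g : Bool) (r : ℕ) (ω' : Finset (ℕ × ℕ)) (hω' : ω' ⊆ E r) (ζ : Finset ℕ) :
    T g (r + 1) (ω' ∪ ζ.image (Prod.mk r)) =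
      T (g || decide (f r ζ = ℓ r)) r ω' ∪ (Icc 0 (f r ζ) ∪
        (if (g = true ∨ f r ζ = ℓ r ∨ ∃ t, t < r ∧ (t, ℓ t) ∈ T (g || decide (f r ζ = ℓ r)) r ω')
          then Icc (ℓ r - h r ζ) (ℓ r) else ∅)).image (Prod.mk r) := by
  rw [hubB_trace_join ℓ E hE θ hθ f h T hT g r ω' hω' ζ]
  have hB := hubB_trace_hasB ℓ θ f h hf T hT (g || decide (f r ζ = ℓ r)) r ω'
  have hiff : (g = true ∨ (∃ s, s < r ∧ f s (θ s ω') = ℓ s) ∨ f r ζ = ℓ r) ↔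
      (g = true ∨ f r ζ = ℓ r ∨ ∃ t, t < r ∧ (t, ℓ t) ∈ T (g || decide (f r ζ = ℓ r)) r ω') := by
    rw [hB, Bool.or_eq_true, decide_eq_true_eq]
    constructor
    · rintro (h1 | ⟨s, hs, h1⟩ | h1)
      · exact Or.inl h1
      · exact Or.inr (Or.inr (Or.inr ⟨s, hs, h1⟩))
      · exact Or.inr (Or.inl h1)
    · rintro (h1 | h1 | ⟨_, _⟩ | h1)
      · exact Or.inl h1
      · exact Or.inr (Or.inr h1)
      · tauto
      · exact Or.inr (Or.inl h1)
  congr 2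
  ext k
  rw [Finset.mem_union, Finset.mem_union, hubB_mem_ite_empty, hubB_mem_ite_empty, hiff]

open Classical in
/-- **Traces of the complement**: if `(f', h')` are the runs of the complementary words (`f' t (ℓ-complement of η) = f t η`, …,
as for `(ra, rb)` versus `(ri, rj)` by `hubB_runs_compl`), then the `(f,h)`-trace of `E n \ ω` is the `(f',h')`-trace of `ω`. [folklore] -/
theorem hubB_trace_compl (ℓ : ℕ → ℕ) (E : ℕ → Finset (ℕ × ℕ)) (hE : ∀ n p, p ∈ E n ↔ p.1 < n ∧ 1 ≤ p.2 ∧ p.2 ≤ ℓ p.1)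
    (θ : ℕ → Finset (ℕ × ℕ) → Finset ℕ) (hθ : ∀ t ω k, k ∈ θ t ω ↔ (t, k) ∈ ω) (f h f' h' : ℕ → Finset ℕ → ℕ)
    (T T' : Bool → ℕ → Finset (ℕ × ℕ) → Finset (ℕ × ℕ))
    (hT : ∀ g n ω, T g n ω = (range n).biUnion (fun t => (Icc 0 (f t (θ t ω)) ∪
      (if (g = true ∨ ∃ s, s < n ∧ f s (θ s ω) = ℓ s) then Icc (ℓ t - h t (θ t ω)) (ℓ t) else ∅)).image (Prod.mk t)))
    (hT' : ∀ g n ω, T' g n ω = (range n).biUnion (fun t => (Icc 0 (f' t (θ t ω)) ∪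
      (if (g = true ∨ ∃ s, s < n ∧ f' s (θ s ω) = ℓ s) then Icc (ℓ t - h' t (θ t ω)) (ℓ t) else ∅)).image (Prod.mk t)))
    (n : ℕ) (hcomp : ∀ t η, t < n → f t (Icc 1 (ℓ t) \ η) = f' t η ∧ h t (Icc 1 (ℓ t) \ η) = h' t η)
    (g : Bool) (ω : Finset (ℕ × ℕ)) : T g n (E n \ ω) = T' g n ω := by
  have hθc : ∀ t, t < n → θ t (E n \ ω) = Icc 1 (ℓ t) \ θ t ω := fun t ht => hubB_theta_sdiff ℓ E hE θ hθ n ω t ht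
  have hfc : ∀ t, t < n → f t (θ t (E n \ ω)) = f' t (θ t ω) := fun t ht => by rw [hθc t ht]; exact (hcomp t _ ht).1
  have hhc : ∀ t, t < n → h t (θ t (E n \ ω)) = h' t (θ t ω) := fun t ht => by rw [hθc t ht]; exact (hcomp t _ ht).2
  have hflag : (∃ s, s < n ∧ f s (θ s (E n \ ω)) = ℓ s) ↔ (∃ s, s < n ∧ f' s (θ s ω) = ℓ s) := by
    constructor
    · rintro ⟨s, hs, h1⟩; exact ⟨s, hs, by rw [← hfc s hs]; exact h1⟩
    · rintro ⟨s, hs, h1⟩; exact ⟨s, hs, by rw [hfc s hs]; exact h1⟩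
  ext p
  rw [hubB_mem_trace ℓ θ f h T hT, hubB_mem_trace ℓ θ f' h' T' hT', hflag]
  constructor
  · rintro ⟨hn, hp⟩
    rw [hfc p.1 hn, hhc p.1 hn] at hp
    exact ⟨hn, hp⟩
  · rintro ⟨hn, hp⟩
    rw [← hfc p.1 hn, ← hhc p.1 hn] at hp
    exact ⟨hn, hp⟩

end Coefficientwise

end Summit.CriticalPhenomena.PercolationContinuityZ3.Theorems
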